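import Literature.NumberTheory.EllipticCurves.ArchimedeanH1CardLeTwo
import Summits.BirchSwinnertonDyer.BirchSwinnertonDyer.Theorems.GenusKolyvaginAtTwoPowDvdShaCardAtTwoRTSelmerLadder
import HarnessLib

/-!
# Route `GenusKolyvaginAtTwo`, crux L⁺_T `PowDvdShaCardAtTwoPosT` (stmt-BirchSwinnertonDyer-23379), LINE 19
# `regular_plus_descent` — TOOLBOX: THE ARCHIMEDEAN BIT (relaxing the real Selmer condition costs ≤ 1 bit) and the
# `Δ > 0` relaxed genus budget `2^{ord₂ C(Wd) + 1}`; the rank-zero side of 3a⁗ on `Δ > 0` reduced to ONE supply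

Seat `bsd-line-gk2-p2` g15 (PROVER seat 2/3, cell `bsd-f1-sign2`), `--supports 23379 --as helper`. THEOREMS ONLY (no
definition, no named fact, no `sorry`). BSD is not proved by any of this; neither is the crux.

On `Δ(W) < 0` (LINE 18) the real place carries no Selmer condition (gk2-p3 `…RelaxedSelmerGenusBudgetNegDisc`); on
`Δ(W) > 0` (LINE 19) it does, and the classes descended from the Heegner field `K` (complex) satisfy it only up to
`H¹(ℝ, E) ≅ ℤ/2`. gk2-p3 g17's handoff: «untouched: the LINE 19 archimedean bit `[res⁻¹Sel : res⁻¹Sel ⊓ ⨅_∞] ≤ 2` on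
`Δ > 0` — needs `#H¹(ℝ, E) ≤ 2`». The Literature file `ArchimedeanH1CardLeTwo` (this seat) proves `#H¹(K_w, E) ≤ 2` at
every infinite place of every number field and `index (selmerLocalKer W K_w n) ≤ 2`. Here:

* §1 `relIndex_inf_iInf_selmerLocalKer_infinitePlace_le_two` — over `ℚ` (one infinite place): for EVERY subgroup
  `X ≤ H¹(ℚ, E[n])`, `[X : X ⊓ ⨅_∞ selmerLocalKer] ≤ 2` (sign-free; on `Δ < 0` the index is `1`).
* §2 `relIndex_selmerGroup_comap_resTorsion_le_two_mul_prod_natCard_twoTorsion` — **the `Δ`-sign-free relaxed genus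
  budget**: `K` imaginary quadratic with odd `d_K`, Heegner for `N_W` ⟹ `[res⁻¹(Sel^(n)(W_K/K)) : Sel^(n)(W/ℚ)] ≤
  2 · ∏_{p ∣ d_K} #E(ℚ_p)[2]` (gk2-p3's budget × the archimedean bit); twin-valuation form `≤ 2^{ord₂ C(Wd) + 1}`.
* §3 `two_mul_sum_le_padicValNat_sha_of_relaxed_supply_heegner_bare` — the rank-zero (odd-depth) side of 3a⁗ for the
  BARE preimage `R = res⁻¹(Sel^(2^M)(W_K/K))` (the relaxed group of LINE 19: archimedean condition dropped), reduced to
  ONE supply statement with `2^{ord₂ C(Wd) + 1} − 1` spare generators (`…RTSelmerLadder` §3).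

References: [MilneADT2006] I Rem. 3.7; [Kramer1981] Thm. 1; [McCallumLMS1991] §5 Prop. 5.2, p. 310.
-/

noncomputable section

-- `Summit.<P>.<Sub>` repeats `BirchSwinnertonDyer` by the tree's layout convention (D-0017)
set_option linter.dupNamespace false

open scoped Classical

namespace Summit.BirchSwinnertonDyer.BirchSwinnertonDyer.Theorems.GenusExact.PlusDescent

open _root_.WeierstrassCurve AddSubgroup NumberField Literature.NumberTheory.EllipticCurves
open Literature.Barriers.BirchSwinnertonDyer

/-! ## §1 The archimedean bit over `ℚ` -/

section Arch

variable (W : WeierstrassCurve ℚ) [W.IsElliptic]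

/-- **The level-`n` real Selmer condition of `E/ℚ` has finite, positive index** (`≠ 0`): it is the preimage of
`ker (H¹(ℚ, E) → H¹(ℝ, E))`, whose index divides into the finite `H¹(ℝ, E)`. [cite: MilneADT2006, I Rem. 3.7] -/
theorem index_selmerLocalKer_infinitePlace_ne_zero (w : InfinitePlace ℚ) (n : ℤ) :
    (selmerLocalKer W w.Completion n).index ≠ 0 := by
  haveI : Finite (W.localH1 w.Completion) := by
    rw [← galoisCohomology_localGaloisModule_one]
    exact W.finite_localH1_infinitePlace w
  have hker : (W.localRestrictionKer w.Completion).index ≠ 0 := by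
    rw [localRestrictionKer_eq_ker, AddSubgroup.index_ker]
    exact Nat.card_pos.ne'
  rw [selmerLocalKer_eq_comap, AddSubgroup.index_comap]
  exact fun h ↦ hker (Nat.eq_zero_of_zero_dvd (h ▸ AddSubgroup.relIndex_dvd_index_of_normal _ _))

/-- **THE ARCHIMEDEAN BIT.** For `E/ℚ`, every level `n` and EVERY subgroup `X ≤ H¹(ℚ, E[n])`:
`[X : X ⊓ (real Selmer condition)] ≤ 2` — `ℚ` has one infinite place (`Unique (InfinitePlace ℚ)`) and the condition there
has index `≤ 2` (`index_selmerLocalKer_infinitePlace_le_two`: `#H¹(ℝ, E) ≤ 2`). [cite: MilneADT2006, I Rem. 3.7] -/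
theorem relIndex_inf_iInf_selmerLocalKer_infinitePlace_le_two (n : ℤ) (X : AddSubgroup (galH1Torsion W n)) :
    (X ⊓ ⨅ w : InfinitePlace ℚ, selmerLocalKer W w.Completion n).relIndex X ≤ 2 := by
  rw [AddSubgroup.inf_relIndex_left, iInf_unique]
  have h2 := W.index_selmerLocalKer_infinitePlace_le_two (default : InfinitePlace ℚ) n
  have h0 := index_selmerLocalKer_infinitePlace_ne_zero W (default : InfinitePlace ℚ) n
  refine le_trans ?_ h2
  rw [← AddSubgroup.relIndex_top_right]
  exact AddSubgroup.relIndex_le_of_le_right le_top (by rwa [AddSubgroup.relIndex_top_right])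

/-- The archimedean bit as a non-vanishing: `[X : X ⊓ ⨅_∞] ≠ 0`. [cite: MilneADT2006, I Rem. 3.7] -/
theorem relIndex_inf_iInf_selmerLocalKer_infinitePlace_ne_zero (n : ℤ) (X : AddSubgroup (galH1Torsion W n)) :
    (X ⊓ ⨅ w : InfinitePlace ℚ, selmerLocalKer W w.Completion n).relIndex X ≠ 0 := by
  rw [AddSubgroup.inf_relIndex_left, iInf_unique]
  have h0 := index_selmerLocalKer_infinitePlace_ne_zero W (default : InfinitePlace ℚ) n
  exact fun h ↦ h0 (Nat.eq_zero_of_zero_dvd (h ▸ AddSubgroup.relIndex_dvd_index_of_normal _ _))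

end Arch

/-! ## §2 The sign-free relaxed genus budget `2 · ∏_{p ∣ d_K} #E(ℚ_p)[2]` -/

section Budget

variable (W : WeierstrassCurve ℚ) [W.IsElliptic] (K : Type) [Field K] [NumberField K]

/-- **The relaxed genus budget WITHOUT the archimedean condition** (any sign of `Δ`): `K` imaginary quadratic with odd
`d_K` satisfying the Heegner hypothesis for `N_W` ⟹ for every level `n`,
`[res⁻¹(Sel^(n)(W_K/K)) : Sel^(n)(W/ℚ)] ≤ 2 · ∏_{p ∣ d_K} #E(ℚ_p)[2]` — gk2-p3's
`relIndex_selmerGroup_relaxed_le_prod_natCard_twoTorsion_of_heegner` (the classes Selmer over `K` AND at `ℝ`) times the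
archimedean bit (§1). This is the LINE 19 (`Δ > 0`) budget `2^{Σ i_p + 1}`. [cite: Kramer1981, §2 Prop. 3 and Thm. 1]
[cite: MilneADT2006, I Rem. 3.7] -/
theorem relIndex_selmerGroup_comap_resTorsion_le_two_mul_prod_natCard_twoTorsion (hIQ : IsImaginaryQuadratic K)
    (hodd : Odd (NumberField.discr K)) (hHe : SatisfiesHeegnerHypothesis (W.conductorNorm ℤ) K) (n : ℤ) :
    (selmerGroup W n).relIndex ((selmerGroup (W.baseChange K) n).comap (resTorsion W K n)) ≤
      2 * ∏ p ∈ (NumberField.discr K).natAbs.primeFactors,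
        Nat.card {P : (W.baseChange ((Matsuno2009.primePlace p).adicCompletion ℚ)).toAffine.Point // 2 • P = 0} := by
  set L : AddSubgroup (galH1Torsion W n) := (selmerGroup (W.baseChange K) n).comap (resTorsion W K n) with hL
  set R : AddSubgroup (galH1Torsion W n) := L ⊓ ⨅ w : InfinitePlace ℚ, selmerLocalKer W w.Completion n with hR
  have hSR : selmerGroup W n ≤ R := selmerGroup_le_relaxed W K n
  have hRL : R ≤ L := inf_le_left
  rw [← AddSubgroup.relIndex_mul_relIndex (selmerGroup W n) R L hSR hRL, mul_comm]
  exact Nat.mul_le_mul (relIndex_inf_iInf_selmerLocalKer_infinitePlace_le_two W n L)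
    (relIndex_selmerGroup_relaxed_le_prod_natCard_twoTorsion_of_heegner W K hIQ hodd hHe n)

/-- If the `ℝ`-conditioned relaxed group has finite index over `Sel`, so does the bare preimage (the archimedean bit
is finite). [folklore] -/
theorem relIndex_selmerGroup_comap_resTorsion_ne_zero (n : ℤ)
    (h : (selmerGroup W n).relIndex ((selmerGroup (W.baseChange K) n).comap (resTorsion W K n) ⊓
      ⨅ w : InfinitePlace ℚ, selmerLocalKer W w.Completion n) ≠ 0) :
    (selmerGroup W n).relIndex ((selmerGroup (W.baseChange K) n).comap (resTorsion W K n)) ≠ 0 := by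
  set L : AddSubgroup (galH1Torsion W n) := (selmerGroup (W.baseChange K) n).comap (resTorsion W K n) with hL
  rw [← AddSubgroup.relIndex_mul_relIndex (selmerGroup W n) _ L (selmerGroup_le_relaxed W K n) inf_le_left]
  exact mul_ne_zero h (relIndex_inf_iInf_selmerLocalKer_infinitePlace_ne_zero W n L)

variable {K}

/-- **The LINE 19 relaxed budget in the twin's Tamagawa currency**: `W` globally minimal with `C(W)` odd, `K` imaginary
quadratic with odd `d_K`, Heegner for `N_W`, `Wd = Cd • W^{(d_K)}` any model ⟹
`[res⁻¹(Sel^(n)(W_K/K)) : Sel^(n)(W/ℚ)] ≤ 2^{ord₂ C(Wd) + 1}`. [cite: Kramer1981, §2 Prop. 3 and Thm. 1] -/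
theorem relIndex_selmerGroup_comap_resTorsion_le_two_pow_padicValNat_tamagawaProduct_twin_succ
    [W.IsGloballyMinimal] (hIQ : IsImaginaryQuadratic K) (hodd : Odd (NumberField.discr K))
    (hHe : SatisfiesHeegnerHypothesis (W.conductorNorm ℤ) K) (hT : Odd W.tamagawaProduct)
    {Wd : WeierstrassCurve ℚ} [Wd.IsElliptic] (Cd : VariableChange ℚ)
    (hWd : Cd • W.quadraticTwist (NumberField.discr K : ℚ) = Wd) (n : ℤ) :
    (selmerGroup W n).relIndex ((selmerGroup (W.baseChange K) n).comap (resTorsion W K n)) ≤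
      2 ^ (padicValNat 2 Wd.tamagawaProduct + 1) := by
  set L : AddSubgroup (galH1Torsion W n) := (selmerGroup (W.baseChange K) n).comap (resTorsion W K n) with hL
  rw [← AddSubgroup.relIndex_mul_relIndex (selmerGroup W n) _ L (selmerGroup_le_relaxed W K n) inf_le_left,
    pow_succ]
  exact Nat.mul_le_mul
    (relIndex_selmerGroup_relaxed_le_two_pow_padicValNat_tamagawaProduct_twin W hIQ hodd hHe hT Cd hWd n)
    (relIndex_inf_iInf_selmerLocalKer_infinitePlace_le_two W n L)

end Budget

/-! ## §3 The rank-zero side of 3a⁗ for the BARE preimage (LINE 19's relaxed group), reduced to one supply -/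

section Frame

variable (W : WeierstrassCurve ℚ) [W.IsElliptic] [W.IsGloballyMinimal] {K : Type} [Field K] [NumberField K]

/-- **RANK-ZERO SIDE OF 3a⁗ WITH THE ARCHIMEDEAN CONDITION DROPPED** (the shape LINE 19 needs on `Δ > 0`; valid for any
sign of `Δ`). Frame: `W` globally minimal, `C(W)` odd, `K` imaginary quadratic with odd `d_K` and Heegner for `N_W`,
`Wd = Cd • W^{(d_K)}`, `rank E(ℚ) = 0`, `#E(ℚ)_tors` odd, `Ш(E/ℚ)[2^∞]` finite and killed by `2^M`, and the `ℝ`-conditioned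
relaxed group of finite index (`hm0`; then so is the bare preimage). SUPPLY: for every `j < k`, every finite
`s ⊆ H¹(ℚ, E[2^M])` with `#s ≤ 2j + (2^{ord₂ C(Wd)+1} − 1)` is avoided by some `z ∈ res⁻¹(Sel^(2^M)(E_K/K))` with
`2^{a_j} ∣ ord z`. CONCLUSION: `2·(a₀ + ⋯ + a_{k-1}) ≤ ord₂ #Ш(E/ℚ)[2^∞]`.
[cite: McCallumLMS1991, §5 Prop. 5.2 and p. 310] [cite: MilneADT2006, I Rem. 3.7] -/
theorem two_mul_sum_le_padicValNat_sha_of_relaxed_supply_heegner_bare (hK : IsImaginaryQuadratic K)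
    (hodd : Odd (NumberField.discr K)) (hH : SatisfiesHeegnerHypothesis (W.conductorNorm ℤ) K)
    (hT : Odd W.tamagawaProduct) {Wd : WeierstrassCurve ℚ} [Wd.IsElliptic] (Cd : VariableChange ℚ)
    (hWd : Cd • W.quadraticTwist (NumberField.discr K : ℚ) = Wd)
    (hrk : W.mordellWeilRank = 0) (htor : Odd W.torsionOrder)
    [Finite (AddCommGroup.primaryComponent W.sha 2)] (M : ℕ)
    (hexp : ∀ y : AddCommGroup.primaryComponent W.sha 2, 2 ^ M • y = 0)
    (hm0 : (selmerGroup W ((2 ^ M : ℕ) : ℤ)).relIndex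
      ((selmerGroup (W.baseChange K) ((2 ^ M : ℕ) : ℤ)).comap (resTorsion W K ((2 ^ M : ℕ) : ℤ)) ⊓
        ⨅ w : InfinitePlace ℚ, selmerLocalKer W w.Completion ((2 ^ M : ℕ) : ℤ)) ≠ 0)
    (k : ℕ) (a : ℕ → ℕ)
    (hsupply : ∀ j < k, ∀ s : Finset (galH1Torsion W ((2 ^ M : ℕ) : ℤ)),
      s.card ≤ 2 * j + (2 ^ (padicValNat 2 Wd.tamagawaProduct + 1) - 1) →
      ∃ z ∈ (selmerGroup (W.baseChange K) ((2 ^ M : ℕ) : ℤ)).comap (resTorsion W K ((2 ^ M : ℕ) : ℤ)),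
        2 ^ a j ∣ addOrderOf z ∧
        Disjoint (zmultiples z) (closure (s : Set (galH1Torsion W ((2 ^ M : ℕ) : ℤ))))) :
    2 * ∑ j ∈ Finset.range k, a j ≤ padicValNat 2 (Nat.card (AddCommGroup.primaryComponent W.sha 2)) := by
  haveI : Fact (Nat.Prime 2) := ⟨Nat.prime_two⟩
  exact two_mul_sum_le_padicValNat_natCard_primaryComponent_sha_of_relaxed_selmer_supply W 2 M
    (exists_zsmul_two_pow_eq_of_rank_zero_of_odd_torsionOrder W hrk htor M) hexp _
    (relIndex_selmerGroup_comap_resTorsion_le_two_pow_padicValNat_tamagawaProduct_twin_succ W hK hodd hH hT Cd hWd _)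
    (relIndex_selmerGroup_comap_resTorsion_ne_zero W K _ hm0) k a hsupply

end Frame

end Summit.BirchSwinnertonDyer.BirchSwinnertonDyer.Theorems.GenusExact.PlusDescent

end
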